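import Summits.Ventures.LatticeQCDFlow.Scoring.NonabelianAreaLaw2DDisjointLoops
import Summits.Ventures.LatticeQCDFlow.Scoring.NonabelianAreaLaw2DOpenWilsonLoop
import Summits.Ventures.LatticeQCDFlow.Scoring.SUNOnePlaquetteBesselSeries
import HarnessLib

/-!
# Two-dimensional `SU(N)` Wilson loops with disjoint interiors are EXACTLY uncorrelated: `⟨tr W_{R₂×T} · tr W'_{R₁×T}⟩_β = ⟨tr W⟩_β · ⟨tr W'⟩_β = N²·P_N(β)^{(R₁+R₂)T}`

HONEST FRAMING: exact (Metropolis-corrected) sampling algorithms for lattice gauge theory;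
figures of merit are autocorrelation/cost numbers at stated couplings and volumes; no
continuum-physics claim.

Venture `LatticeQCDFlow` (cell pub-lqcd), sub-topic `Scoring`; FANOUT row 5 (`s0-sun-a`), GEN-21.
NEW WORK of the cell (placement rule).  The `SU(N)` trace form (twin of `UNDisjointWilsonLoops2D`) of part VII of the area law
(`NonabelianAreaLaw2DDisjointLoops`): on the free-boundary `(R₁ + R₂) × T` block with corner `(i, j)` of
two-dimensional `SU(N)` lattice Yang–Mills (every `N ≥ 1`, every real `β`, weight `e^{−β(N − Re tr U_p)}`,
`R₁ + R₂ + 1 ≤ L`, `T + 1 ≤ L`), the ADJACENT loops `W' = W_{R₁×T}` (corner `(i, j)`) and `W = W_{R₂×T}` (corner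
`(i + R₁, j)`, sharing the edge line `x = i + R₁` with `W'`) satisfy

  **`⟨tr W · tr W'⟩_β = N·P_N(β)^{R₂T} · N·P_N(β)^{R₁T}`** = `⟨tr W⟩_β · ⟨tr W'⟩_β` (GEN-18's exact means),

`P_N = ∫N⁻¹Re tr u·e^{−β(N−Re tr u)}du / ∫e^{−β(N−Re tr u)}du` over `SU(N)`: the covariance of the two loop measurements VANISHES
IDENTICALLY — in two dimensions only overlapping loops are correlated (the nested case is GEN-21's
`SUNNestedWilsonLoop{Covariance,TraceProduct}2D`).  Route: part VII entrywise on the diagonals, Schur (`M = m·1`,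
`specialUnitary_integralMatrix_eq_smul_one`) for both factors, GEN-18's partition function `Z = (e^{−Nβ}D)^{(R₁+R₂)T}`,
`D = Σ_q det[I_{|q+i−j|}(β)]`.

* `specialUnitary_open_trace_shifted_mul_trace_integral_eq` (unnormalised: `= N² m^{(R₁+R₂)T}`),
  **`specialUnitary_open_trace_shifted_mul_trace_eq`**.

No `def`, nothing cited as a fact, 0 sorry.
-/

noncomputable section

open MeasureTheory Function Finset
open Literature.MathematicalPhysics.QuantumFieldTheory
open Literature.MathematicalPhysics.QuantumLattice
open Summit.Ventures.LatticeQCDFlow.Theory2.Lattice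
open Summit.Ventures.LatticeQCDFlow.Theory2.Lattice.TwoDim
open Literature.Analysis.FunctionSpaces (besselI)

namespace Summit.Ventures.LatticeQCDFlow.Scoring

section Disjoint

variable {L : ℕ} [NeZero L] {N : ℕ}

/-- **UNNORMALISED** (`SU(N)`, adjacent loops `W = W_{R₂×T}` at `(i + R₁, j)`, `W' = W_{R₁×T}` at `(i, j)`):
`∫ tr W · tr W' ∏_{p∈B_{(R₁+R₂)×T}} e^{−β(N−Re tr U_p)} = N² · m^{(R₁+R₂)T}`, `m = N⁻¹∫Re tr u·e^{−β(N−Re tr u)}du`. -/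
theorem specialUnitary_open_trace_shifted_mul_trace_integral_eq (β : ℝ) (i j : ZMod L) {R₁ R₂ T : ℕ}
    (hR : R₁ + R₂ + 1 ≤ L) (hT : T + 1 ≤ L) :
    ∫ U, ((rectangleHolonomy U ![i + R₁, j] 0 1 R₂ T : Matrix.specialUnitaryGroup (Fin N) ℂ) : Matrix (Fin N) (Fin N) ℂ).trace *
        ((rectangleHolonomy U ![i, j] 0 1 R₁ T : Matrix.specialUnitaryGroup (Fin N) ℂ) : Matrix (Fin N) (Fin N) ℂ).trace *
        ∏ p ∈ (range (R₁ + R₂) ×ˢ range T).image (fun q : ℕ × ℕ => (![i + q.1, j + q.2] : Site 2 L)),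
          (Real.exp (-(β * ((N : ℝ) - ((plaquetteHolonomy U p 0 1 : Matrix.specialUnitaryGroup (Fin N) ℂ) :
            Matrix (Fin N) (Fin N) ℂ).trace.re))) : ℂ)
        ∂(Measure.pi fun _ : Edge 2 L => haarProbability (Matrix.specialUnitaryGroup (Fin N) ℂ)) =
      (N : ℂ) ^ 2 *
        (((N : ℝ)⁻¹ * ∫ u, ((u : Matrix.specialUnitaryGroup (Fin N) ℂ) : Matrix (Fin N) (Fin N) ℂ).trace.re *
          Real.exp (-(β * ((N : ℝ) - ((u : Matrix.specialUnitaryGroup (Fin N) ℂ) : Matrix (Fin N) (Fin N) ℂ).trace.re)))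
          ∂(haarProbability (Matrix.specialUnitaryGroup (Fin N) ℂ)) : ℝ) : ℂ) ^ ((R₁ + R₂) * T) := by
  set ρ := fundamentalRep (Fin N) with hρ
  have hw : Continuous fun u : Matrix.specialUnitaryGroup (Fin N) ℂ =>
      Real.exp (-(β * ((N : ℝ) - ((u : Matrix.specialUnitaryGroup (Fin N) ℂ) : Matrix (Fin N) (Fin N) ℂ).trace.re))) := by
    fun_prop
  have hF : Continuous fun x : ℝ => Real.exp (-(β * ((N : ℝ) - x))) := by fun_prop
  -- part VII entrywise (`R₁' = R₁`) and part I's single-loop area law for the left loop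
  have hdis := integral_rep_rectangleHolonomy_shifted_mul_rep_mul_prod_weight (L := L) ρ ρ
    (continuous_fundamentalRep (Fin N)) (continuous_fundamentalRep (Fin N)) hw
    (specialUnitary_wilsonWeight_conj N β) i j hT (le_refl R₁)
  have hone := integral_rep_rectangleHolonomy_mul_prod_weight (L := L) ρ (continuous_fundamentalRep (Fin N))
    hw (specialUnitary_wilsonWeight_conj N β) i j hT (R := R₁) (by omega)
  -- the one-plaquette matrix is scalar
  set m : ℝ := (N : ℝ)⁻¹ * ∫ u, ((u : Matrix.specialUnitaryGroup (Fin N) ℂ) : Matrix (Fin N) (Fin N) ℂ).trace.re *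
      Real.exp (-(β * ((N : ℝ) - ((u : Matrix.specialUnitaryGroup (Fin N) ℂ) : Matrix (Fin N) (Fin N) ℂ).trace.re)))
      ∂(haarProbability (Matrix.specialUnitaryGroup (Fin N) ℂ)) with hm
  have hM : (Matrix.of fun k l : Fin N => ∫ g, ρ g k l *
      (Real.exp (-(β * ((N : ℝ) - ((g : Matrix.specialUnitaryGroup (Fin N) ℂ) : Matrix (Fin N) (Fin N) ℂ).trace.re))) : ℂ)
        ∂(haarProbability (Matrix.specialUnitaryGroup (Fin N) ℂ))) = (m : ℂ) • (1 : Matrix (Fin N) (Fin N) ℂ) := by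
    simp only [hρ, fundamentalRep_apply]
    exact specialUnitary_integralMatrix_eq_smul_one N hF
  -- continuity / integrability
  have hΨc : Continuous fun U : GaugeConfig 2 L (Matrix.specialUnitaryGroup (Fin N) ℂ) =>
      ∏ p ∈ (range (R₁ + R₂) ×ˢ range T).image (fun q : ℕ × ℕ => (![i + q.1, j + q.2] : Site 2 L)),
        (Real.exp (-(β * ((N : ℝ) - ((plaquetteHolonomy U p 0 1 : Matrix.specialUnitaryGroup (Fin N) ℂ) :
          Matrix (Fin N) (Fin N) ℂ).trace.re))) : ℂ) :=
    continuous_finsetProd _ fun p _ => Complex.continuous_ofReal.comp (hw.comp (continuous_config_plaquetteHolonomy p 0 1))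
  have hint : ∀ a c : Fin N, Integrable (fun U : GaugeConfig 2 L (Matrix.specialUnitaryGroup (Fin N) ℂ) =>
      ρ (rectangleHolonomy U ![i + R₁, j] 0 1 R₂ T) a a * ρ (rectangleHolonomy U ![i, j] 0 1 R₁ T) c c *
        ∏ p ∈ (range (R₁ + R₂) ×ˢ range T).image (fun q : ℕ × ℕ => (![i + q.1, j + q.2] : Site 2 L)),
          (Real.exp (-(β * ((N : ℝ) - ((plaquetteHolonomy U p 0 1 : Matrix.specialUnitaryGroup (Fin N) ℂ) :
            Matrix (Fin N) (Fin N) ℂ).trace.re))) : ℂ))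
      (Measure.pi fun _ : Edge 2 L => haarProbability (Matrix.specialUnitaryGroup (Fin N) ℂ)) := fun a c =>
    integrable_gaugeConfig_of_continuous (((((continuous_fundamentalRep (Fin N)).comp
      (continuous_config_rectangleHolonomy _ 0 1 R₂ T)).matrix_elem a a).mul
      (((continuous_fundamentalRep (Fin N)).comp (continuous_config_rectangleHolonomy _ 0 1 R₁ T)).matrix_elem c c)).mul hΨc)
  -- expand tr · tr into diagonal entries
  have hpt : ∀ U : GaugeConfig 2 L (Matrix.specialUnitaryGroup (Fin N) ℂ),
      ((rectangleHolonomy U ![i + R₁, j] 0 1 R₂ T : Matrix.specialUnitaryGroup (Fin N) ℂ) : Matrix (Fin N) (Fin N) ℂ).trace *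
        ((rectangleHolonomy U ![i, j] 0 1 R₁ T : Matrix.specialUnitaryGroup (Fin N) ℂ) : Matrix (Fin N) (Fin N) ℂ).trace *
        ∏ p ∈ (range (R₁ + R₂) ×ˢ range T).image (fun q : ℕ × ℕ => (![i + q.1, j + q.2] : Site 2 L)),
          (Real.exp (-(β * ((N : ℝ) - ((plaquetteHolonomy U p 0 1 : Matrix.specialUnitaryGroup (Fin N) ℂ) :
            Matrix (Fin N) (Fin N) ℂ).trace.re))) : ℂ) =
      ∑ a, ∑ c, ρ (rectangleHolonomy U ![i + R₁, j] 0 1 R₂ T) a a * ρ (rectangleHolonomy U ![i, j] 0 1 R₁ T) c c *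
        ∏ p ∈ (range (R₁ + R₂) ×ˢ range T).image (fun q : ℕ × ℕ => (![i + q.1, j + q.2] : Site 2 L)),
          (Real.exp (-(β * ((N : ℝ) - ((plaquetteHolonomy U p 0 1 : Matrix.specialUnitaryGroup (Fin N) ℂ) :
            Matrix (Fin N) (Fin N) ℂ).trace.re))) : ℂ) := by
    intro U
    rw [Matrix.trace, Matrix.trace, Finset.sum_mul, Finset.sum_mul]
    refine Finset.sum_congr rfl fun a _ => ?_
    rw [Matrix.diag_apply, Finset.mul_sum, Finset.sum_mul]
    rfl
  rw [integral_congr_ae (ae_of_all _ hpt), integral_finsetSum _ fun a _ => integrable_finsetSum _ fun c _ => hint a c]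
  simp_rw [integral_finsetSum _ fun c _ => hint _ c]
  -- the left loop alone: `∫ ρ(W')_{cc} ∏_{B_{R₁×T}} w = m^{R₁T}`
  have hleft : ∀ c : Fin N, ∫ U, ρ (rectangleHolonomy U ![i, j] 0 1 R₁ T) c c *
      ∏ p ∈ (range R₁ ×ˢ range T).image (fun q : ℕ × ℕ => (![i + q.1, j + q.2] : Site 2 L)),
        (Real.exp (-(β * ((N : ℝ) - ((plaquetteHolonomy U p 0 1 : Matrix.specialUnitaryGroup (Fin N) ℂ) :
          Matrix (Fin N) (Fin N) ℂ).trace.re))) : ℂ)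
      ∂(Measure.pi fun _ : Edge 2 L => haarProbability (Matrix.specialUnitaryGroup (Fin N) ℂ)) = (m : ℂ) ^ (R₁ * T) := by
    intro c
    rw [hone c c, hM, smul_pow, one_pow, Matrix.smul_apply, Matrix.one_apply_eq, smul_eq_mul, mul_one]
  have hterm : ∀ a c : Fin N,
      ∫ U, ρ (rectangleHolonomy U ![i + R₁, j] 0 1 R₂ T) a a * ρ (rectangleHolonomy U ![i, j] 0 1 R₁ T) c c *
        ∏ p ∈ (range (R₁ + R₂) ×ˢ range T).image (fun q : ℕ × ℕ => (![i + q.1, j + q.2] : Site 2 L)),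
          (Real.exp (-(β * ((N : ℝ) - ((plaquetteHolonomy U p 0 1 : Matrix.specialUnitaryGroup (Fin N) ℂ) :
            Matrix (Fin N) (Fin N) ℂ).trace.re))) : ℂ)
        ∂(Measure.pi fun _ : Edge 2 L => haarProbability (Matrix.specialUnitaryGroup (Fin N) ℂ)) =
      (m : ℂ) ^ (R₂ * T) * (m : ℂ) ^ (R₁ * T) := by
    intro a c
    rw [hdis c c R₂ hR a a, hM, smul_pow, one_pow, Matrix.smul_apply, Matrix.one_apply_eq, smul_eq_mul, mul_one,
      hleft c]
  simp_rw [hterm]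
  simp only [Finset.sum_const, Finset.card_univ, Fintype.card_fin, nsmul_eq_mul]
  rw [← pow_add, show R₂ * T + R₁ * T = (R₁ + R₂) * T by ring]
  ring


/-- **TWO `SU(N)` WILSON LOOPS WITH DISJOINT INTERIORS ARE EXACTLY UNCORRELATED** (every `N ≥ 1`, every real `β`;
adjacent loops `W = W_{R₂×T}` at `(i + R₁, j)` and `W' = W_{R₁×T}` at `(i, j)` in the free-boundary `(R₁+R₂) × T` block,
`R₁ + R₂ + 1 ≤ L`, `T + 1 ≤ L`):
`⟨tr W · tr W'⟩_β = (N·P_N(β)^{R₂T}) · (N·P_N(β)^{R₁T}) = ⟨tr W⟩_β · ⟨tr W'⟩_β`,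
`P_N = (N⁻¹∫Re tr u·e^{−β(N−Re tr u)}du)/(∫e^{−β(N−Re tr u)}du)` over `SU(N)`. -/
theorem specialUnitary_open_trace_shifted_mul_trace_eq [NeZero N] (β : ℝ) (i j : ZMod L) {R₁ R₂ T : ℕ}
    (hR : R₁ + R₂ + 1 ≤ L) (hT : T + 1 ≤ L) :
    (∫ U, ((rectangleHolonomy U ![i + R₁, j] 0 1 R₂ T : Matrix.specialUnitaryGroup (Fin N) ℂ) : Matrix (Fin N) (Fin N) ℂ).trace *
        ((rectangleHolonomy U ![i, j] 0 1 R₁ T : Matrix.specialUnitaryGroup (Fin N) ℂ) : Matrix (Fin N) (Fin N) ℂ).trace *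
        ∏ p ∈ (range (R₁ + R₂) ×ˢ range T).image (fun q : ℕ × ℕ => (![i + q.1, j + q.2] : Site 2 L)),
          (Real.exp (-(β * ((N : ℝ) - ((plaquetteHolonomy U p 0 1 : Matrix.specialUnitaryGroup (Fin N) ℂ) :
            Matrix (Fin N) (Fin N) ℂ).trace.re))) : ℂ)
        ∂(Measure.pi fun _ : Edge 2 L => haarProbability (Matrix.specialUnitaryGroup (Fin N) ℂ))) /
      ((∫ U, ∏ p ∈ (range (R₁ + R₂) ×ˢ range T).image (fun q : ℕ × ℕ => (![i + q.1, j + q.2] : Site 2 L)),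
          Real.exp (-(β * ((N : ℝ) - ((plaquetteHolonomy U p 0 1 : Matrix.specialUnitaryGroup (Fin N) ℂ) :
            Matrix (Fin N) (Fin N) ℂ).trace.re)))
        ∂(Measure.pi fun _ : Edge 2 L => haarProbability (Matrix.specialUnitaryGroup (Fin N) ℂ)) : ℝ) : ℂ) =
      ((N : ℂ) * ((((N : ℝ)⁻¹ * ∫ u, ((u : Matrix.specialUnitaryGroup (Fin N) ℂ) : Matrix (Fin N) (Fin N) ℂ).trace.re *
          Real.exp (-(β * ((N : ℝ) - ((u : Matrix.specialUnitaryGroup (Fin N) ℂ) : Matrix (Fin N) (Fin N) ℂ).trace.re)))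
          ∂(haarProbability (Matrix.specialUnitaryGroup (Fin N) ℂ))) /
          (∫ u, Real.exp (-(β * ((N : ℝ) - ((u : Matrix.specialUnitaryGroup (Fin N) ℂ) : Matrix (Fin N) (Fin N) ℂ).trace.re)))
            ∂(haarProbability (Matrix.specialUnitaryGroup (Fin N) ℂ))) : ℝ) : ℂ) ^ (R₂ * T)) *
      ((N : ℂ) * ((((N : ℝ)⁻¹ * ∫ u, ((u : Matrix.specialUnitaryGroup (Fin N) ℂ) : Matrix (Fin N) (Fin N) ℂ).trace.re *
          Real.exp (-(β * ((N : ℝ) - ((u : Matrix.specialUnitaryGroup (Fin N) ℂ) : Matrix (Fin N) (Fin N) ℂ).trace.re)))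
          ∂(haarProbability (Matrix.specialUnitaryGroup (Fin N) ℂ))) /
          (∫ u, Real.exp (-(β * ((N : ℝ) - ((u : Matrix.specialUnitaryGroup (Fin N) ℂ) : Matrix (Fin N) (Fin N) ℂ).trace.re)))
            ∂(haarProbability (Matrix.specialUnitaryGroup (Fin N) ℂ))) : ℝ) : ℂ) ^ (R₁ * T)) := by
  set m : ℝ := (N : ℝ)⁻¹ * ∫ u, ((u : Matrix.specialUnitaryGroup (Fin N) ℂ) : Matrix (Fin N) (Fin N) ℂ).trace.re *
      Real.exp (-(β * ((N : ℝ) - ((u : Matrix.specialUnitaryGroup (Fin N) ℂ) : Matrix (Fin N) (Fin N) ℂ).trace.re)))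
      ∂(haarProbability (Matrix.specialUnitaryGroup (Fin N) ℂ)) with hm
  set D : ℝ := (∑' q : ℤ, (Matrix.of fun i j : Fin N => besselI (q + (i : ℤ) - (j : ℤ)).natAbs β).det) with hD
  have hDpos : 0 < D := by
    rw [hD, ← integral_haar_specialUnitaryGroup_fin_exp_mul_trace_re N β]
    exact integral_exp_pos ((by fun_prop : Continuous fun u : Matrix.specialUnitaryGroup (Fin N) ℂ =>
      Real.exp (β * ((u : Matrix.specialUnitaryGroup (Fin N) ℂ) : Matrix (Fin N) (Fin N) ℂ).trace.re)).integrable_of_hasCompactSupport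
        (HasCompactSupport.of_compactSpace _))
  have hZ1 : ∫ u, Real.exp (-(β * ((N : ℝ) - ((u : Matrix.specialUnitaryGroup (Fin N) ℂ) : Matrix (Fin N) (Fin N) ℂ).trace.re)))
      ∂(haarProbability (Matrix.specialUnitaryGroup (Fin N) ℂ)) = Real.exp (-(N * β)) * D := by
    have hsplit : ∀ u : Matrix.specialUnitaryGroup (Fin N) ℂ,
        Real.exp (-(β * ((N : ℝ) - ((u : Matrix.specialUnitaryGroup (Fin N) ℂ) : Matrix (Fin N) (Fin N) ℂ).trace.re))) =
          Real.exp (-(N * β)) * Real.exp (β * ((u : Matrix.specialUnitaryGroup (Fin N) ℂ) : Matrix (Fin N) (Fin N) ℂ).trace.re) := by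
      intro u; rw [← Real.exp_add]; congr 1; ring
    simp_rw [hsplit]
    rw [integral_const_mul, integral_haar_specialUnitaryGroup_fin_exp_mul_trace_re]
  have hE : (0 : ℝ) < Real.exp (-(N * β)) := Real.exp_pos _
  rw [specialUnitary_open_partitionFunction_eq N β i j hR hT,
    specialUnitary_open_trace_shifted_mul_trace_integral_eq (L := L) β i j hR hT, ← hD, ← hm, hZ1]
  have hE0 : (Real.exp (-(N * β)) : ℂ) ≠ 0 := by exact_mod_cast hE.ne'
  have hD0 : (D : ℂ) ≠ 0 := by exact_mod_cast hDpos.ne'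
  have hq : (((m / (Real.exp (-(N * β)) * D)) : ℝ) : ℂ) = (m : ℂ) / ((Real.exp (-(N * β)) : ℂ) * (D : ℂ)) := by
    push_cast; ring
  have hz : ((((Real.exp (-(N * β)) * D) ^ ((R₁ + R₂) * T)) : ℝ) : ℂ) =
      ((Real.exp (-(N * β)) : ℂ) * (D : ℂ)) ^ ((R₁ + R₂) * T) := by
    rw [Complex.ofReal_pow, Complex.ofReal_mul]
  rw [hq, hz, show (R₁ + R₂) * T = R₂ * T + R₁ * T by ring, pow_add, pow_add, div_pow, div_pow]
  field_simp

end Disjoint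

end Summit.Ventures.LatticeQCDFlow.Scoring
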